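import Literature.Analysis.FluidPDE.ElgindiDivisionBySinStrip
import Mathlib.Analysis.Calculus.LocalExtr.Rolle
import HarnessLib

/-!
# `|∂_θΨ|_{𝓗⁴} ≤ C|∂_θθΨ|_{𝓗⁴}` for functions vanishing on the sides of the strip
([Elgindi2021] §9.2.2 / [ElgindiGhoulMasmoudi2021] §2.3.1: from Theorem 2's `∂_θθ`-control to the
velocities)

Topic `Literature/Analysis/FluidPDE`. Proof file (everything proved, no definitions, no named
facts) on the proof path of the named fact
`Literature.Analysis.FluidPDE.Elgindi.ElgindiGhoulMasmoudi2021_stabilityCore`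
(`ElgindiStabilityDecomposition.lean`). T. M. Elgindi, Ann. of Math. 194 (2021) =
arXiv:1904.04795, §9.2.2 (p. 32): "by Theorem (RemovingL12) … by Proposition (DivisionBySin), we have
`|U(Φ_g − (4α)⁻¹ sin 2θ L₁₂(g))/sin 2θ|_{𝓗⁴} ≤ C|g|_{𝓗⁴}`" — Theorem 2 bounds `∂_θθ` of the reduced
stream function, Proposition 8.21 needs `∂_θ` of the numerator: the passage is the present weighted
Poincaré inequality for functions with zero boundary values; Elgindi–Ghoul–Masmoudi,
arXiv:1910.14071, §2.3.1 (pp. 8–9), (2.10)–(2.12).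

For `Ψ` smooth on `ℝ²` (`Smooth2`) with `Ψ(z,0) = Ψ(z,π/2) = 0` and `0 < α ≤ 1`:
* **slice, radial part** (`wsq_neg_eta_deriv_le`): for `u ∈ C^∞(ℝ)` with `u(0) = u(π/2) = 0`,
  `∫ u′²S^{−η} ≤ 500∫ u″²S^{−η}` (Rolle gives a zero of `u′`, then Cauchy–Schwarz and
  `∫₀^{π/2} S^{−η} ≤ 100π`);
* **slice, angular words** (`sum_wsq_iterate_Dθ₁_le_deriv`):
  `Σ_{i≤n} ∫(D_θⁱv)²S^{−γ} ≤ 4·10⁹(Σ_{l≤n−1} ∫(D_θˡv′)²S^{−γ} + ∫v′²S^{−η})` for any smooth `v` (the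
  up/down conversions of `ElgindiDivisionBySin` and `v⁽ᵐ⁾ = (v′)⁽ᵐ⁻¹⁾`);
* **strip** (`eHkNormSq_dθ_le`): `|∂_θΨ|²_{𝓗⁴} ≤ 10¹²·|∂_θθΨ|²_{𝓗⁴}` in the tree's `eHkNormSq α 4`.
[folklore] for the inequalities themselves (Poincaré–Wirtinger with weights); the cites record
their role in the printed proofs.
-/

noncomputable section

open Set Real MeasureTheory Finset Function intervalIntegral
open _root_.Topology
open scoped ContDiff ENNReal

namespace Literature.Analysis.FluidPDE

namespace Elgindi

/-- `1 ≤ ∞` (private copy of a landed one-liner). [folklore] -/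
private theorem one_le_infty'' : (1 : WithTop ℕ∞) ≤ ((⊤ : ℕ∞) : WithTop ℕ∞) := WithTop.coe_le_coe.2 le_top

/-- Finite orders are below `∞` (private copy of a landed one-liner). [folklore] -/
private theorem natCast_le_infty'' (m : ℕ) : (m : WithTop ℕ∞) ≤ ((⊤ : ℕ∞) : WithTop ℕ∞) := WithTop.coe_le_coe.2 le_top

/-! ### The radial part of a slice: Poincaré for the derivative of a function with zero ends -/

/-- **`∫ u′²S^{−η} ≤ 500·∫ u″²S^{−η}`** for `u ∈ C^∞(ℝ)` with `u(0) = u(π/2) = 0` (`S = sin 2θ`,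
`η = 99/100`): `u′` has a zero (Rolle), so `u′² ≤ (π/2)∫u″² ≤ (π/2)∫u″²S^{−η}` pointwise, and
`∫₀^{π/2}S^{−η} ≤ 100π`. [folklore] -/
theorem wsq_neg_eta_deriv_le {u : ℝ → ℝ} (hu : ContDiff ℝ ∞ u) (h0 : u 0 = 0) (h1 : u (π / 2) = 0) :
    wsq (-eta) (deriv u) ≤ 500 * wsq (-eta) (deriv (deriv u)) := by
  have hπ := Real.pi_pos
  have hb : (0:ℝ) < π / 2 := by positivity
  set v := deriv u with hv
  set w := deriv v with hw
  have hvs : ContDiff ℝ ∞ v := hu.deriv'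
  have hws : ContDiff ℝ ∞ w := hvs.deriv'
  have hvc : Continuous v := hvs.continuous
  have hwc : Continuous w := hws.continuous
  have hvd : ∀ θ, HasDerivAt v (w θ) θ := fun θ => by
    have := ((hvs.differentiable (by simp)) θ).hasDerivAt; rwa [← hw] at this
  -- a zero of `v`
  obtain ⟨θ₀, hθ₀, hv0⟩ := exists_deriv_eq_zero hb hu.continuous.continuousOn (h0.trans h1.symm)
  -- `W = ∫ w² S^{−η}`, `∫ w² ≤ W`
  set W := wsq (-eta) w with hW
  have hW0 : 0 ≤ W := wsq_nonneg _ _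
  have iw2 : IntegrableOn (fun θ => w θ ^ 2) (Ioo 0 (π / 2)) := integrableOn_Ioo_of_continuous (hwc.pow 2)
  have iw2η : IntegrableOn (fun θ => w θ ^ 2 * Real.sin (2 * θ) ^ (-eta)) (Ioo 0 (π / 2)) := integrableOn_sq_mul_sin_rpow_neg_eta hwc
  have hle1 : ∫ θ in Ioo 0 (π / 2), w θ ^ 2 ≤ W := by
    refine setIntegral_mono_on iw2 iw2η measurableSet_Ioo fun θ hθ => ?_
    have h1 : 1 ≤ Real.sin (2 * θ) ^ (-eta) :=
      Real.one_le_rpow_of_pos_of_le_one_of_nonpos (sin_two_mul_pos_of_mem hθ) (sin_two_mul_le_one' θ) (by norm_num [eta])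
    nlinarith [sq_nonneg (w θ)]
  -- `∫ |w| ≤ √(π/2)·√W`
  have iabs : IntegrableOn (fun θ => |w θ|) (Ioo 0 (π / 2)) := integrableOn_Ioo_of_continuous hwc.abs
  have habs : (∫ θ in Ioo 0 (π / 2), |w θ|) ^ 2 ≤ (π / 2) * W := by
    have i1 : IntegrableOn (fun _ : ℝ => (1:ℝ) ^ 2) (Ioo 0 (π / 2)) := integrableOn_Ioo_of_continuous continuous_const
    have i2 : IntegrableOn (fun θ => |w θ| ^ 2) (Ioo 0 (π / 2)) := by simp only [sq_abs]; exact iw2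
    have i3 : IntegrableOn (fun θ => |w θ| * 1) (Ioo 0 (π / 2)) := by simp only [mul_one]; exact iabs
    have hcs := sq_integral_mul_le (μ := volume.restrict (Ioo (0:ℝ) (π / 2))) (φ := fun θ => |w θ|) (ψ := fun _ => (1:ℝ)) i2 i1 i3
    simp only [mul_one, sq_abs, one_pow] at hcs
    have hc : ∫ _θ in Ioo (0:ℝ) (π / 2), (1:ℝ) = π / 2 := by
      rw [setIntegral_const, smul_eq_mul, mul_one, Real.volume_real_Ioo_of_le hb.le, sub_zero]
    rw [hc] at hcs
    calc (∫ θ in Ioo 0 (π / 2), |w θ|) ^ 2 ≤ (∫ θ in Ioo 0 (π / 2), w θ ^ 2) * (π / 2) := hcs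
      _ ≤ W * (π / 2) := mul_le_mul_of_nonneg_right hle1 hb.le
      _ = _ := mul_comm _ _
  -- pointwise bound of `v` on `(0, π/2)`
  have hvpt : ∀ θ ∈ Ioo (0:ℝ) (π / 2), v θ ^ 2 ≤ (π / 2) * W := fun θ hθ => by
    have hft : ∫ t in θ₀..θ, w t = v θ - v θ₀ := integral_eq_sub_of_hasDerivAt (fun t _ => hvd t) (hwc.intervalIntegrable _ _)
    have hv0' : v θ₀ = 0 := hv0
    rw [hv0', sub_zero] at hft
    have hsub : Set.uIoc θ₀ θ ⊆ Ioo 0 (π / 2) := fun t ht => by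
      rw [Set.mem_uIoc] at ht
      rcases ht with ⟨ha, hb'⟩ | ⟨ha, hb'⟩
      · exact ⟨hθ₀.1.trans ha, hb'.trans_lt hθ.2⟩
      · exact ⟨hθ.1.trans ha, hb'.trans_lt hθ₀.2⟩
    have hle : |v θ| ≤ ∫ t in Ioo 0 (π / 2), |w t| := by
      rw [← hft]
      calc |∫ t in θ₀..θ, w t| ≤ ∫ t in Set.uIoc θ₀ θ, |w t| := by
            have := intervalIntegral.norm_integral_le_integral_norm_uIoc (f := w) (μ := volume) (a := θ₀) (b := θ)
            simpa only [Real.norm_eq_abs] using this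
        _ ≤ ∫ t in Ioo 0 (π / 2), |w t| :=
            setIntegral_mono_set iabs (ae_of_all _ fun t => abs_nonneg _) (Filter.Eventually.of_forall hsub)
    have hnn : 0 ≤ ∫ t in Ioo 0 (π / 2), |w t| := setIntegral_nonneg measurableSet_Ioo fun t _ => abs_nonneg _
    calc v θ ^ 2 = |v θ| ^ 2 := (sq_abs _).symm
      _ ≤ (∫ t in Ioo 0 (π / 2), |w t|) ^ 2 := pow_le_pow_left₀ (abs_nonneg _) hle 2
      _ ≤ (π / 2) * W := habs
  -- integrate against `S^{−η}`
  have hI := integral_sin_two_mul_rpow_le (r := -eta) (by norm_num [eta]) (by norm_num [eta])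
  have hI' : ∫ θ in Ioo 0 (π / 2), Real.sin (2 * θ) ^ (-eta) ≤ 100 * π := by
    refine hI.trans (le_of_eq ?_); norm_num [eta]; ring
  have iv : IntegrableOn (fun θ => v θ ^ 2 * Real.sin (2 * θ) ^ (-eta)) (Ioo 0 (π / 2)) := integrableOn_sq_mul_sin_rpow_neg_eta hvc
  have ic : IntegrableOn (fun θ => (π / 2) * W * Real.sin (2 * θ) ^ (-eta)) (Ioo 0 (π / 2)) :=
    (integrableOn_sin_two_mul_rpow (r := -eta) (by norm_num [eta]) (by norm_num [eta])).const_mul _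
  have hmain : wsq (-eta) v ≤ (π / 2) * W * (100 * π) := by
    unfold wsq
    calc ∫ θ in Ioo 0 (π / 2), v θ ^ 2 * Real.sin (2 * θ) ^ (-eta) ≤ ∫ θ in Ioo 0 (π / 2), (π / 2) * W * Real.sin (2 * θ) ^ (-eta) :=
          setIntegral_mono_on iv ic measurableSet_Ioo fun θ hθ =>
            mul_le_mul_of_nonneg_right (hvpt θ hθ) (Real.rpow_nonneg (sin_two_mul_pos_of_mem hθ).le _)
      _ = (π / 2) * W * ∫ θ in Ioo 0 (π / 2), Real.sin (2 * θ) ^ (-eta) := MeasureTheory.integral_const_mul _ _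
      _ ≤ (π / 2) * W * (100 * π) := mul_le_mul_of_nonneg_left hI' (by positivity)
  have hπ2 : π ^ 2 < 10 := by nlinarith [Real.pi_lt_d2, Real.pi_pos]
  calc wsq (-eta) v ≤ (π / 2) * W * (100 * π) := hmain
    _ = 50 * π ^ 2 * W := by ring
    _ ≤ 500 * W := by nlinarith [hπ2, hW0]

/-! ### The angular words of a slice -/

/-- **`Σ_{i≤n} ∫(D_θⁱv)²S^{−γ} ≤ 4·10⁹·(Σ_{l≤n−1} ∫(D_θˡv′)²S^{−γ} + ∫v′²S^{−η})`** for smooth `v`, `n ≤ 4`,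
`1 < γ < 2` (no boundary conditions: every word `D_θⁱv`, `i ≥ 1`, contains the factor `sin 2θ·v′`).
[folklore] -/
theorem sum_wsq_iterate_Dθ₁_le_deriv {γ : ℝ} (hγ1 : 1 < γ) (hγ2 : γ < 2) {v : ℝ → ℝ} (hv : ContDiff ℝ ∞ v) {n : ℕ} (hn : n ≤ 4) :
    (∑ i ∈ range n, wsq (-γ) (Dθ₁^[i + 1] v)) ≤
      4 * 10 ^ 9 * ((∑ i ∈ range (n - 1), wsq (-γ) (Dθ₁^[i + 1] (deriv v))) + wsq (-eta) (deriv v)) := by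
  have hη : eta = 99 / 100 := rfl
  set w := deriv v with hw
  have hws : ContDiff ℝ ∞ w := hv.deriv'
  obtain ⟨-, u1, u2, u3, u4⟩ := wsq_iterate_Dθ₁_le hγ2 hv
  obtain ⟨d1, d2, d3, -⟩ := wsq_iteratedDeriv_le_wsq_iterate_Dθ₁ hγ2 hws
  -- `v⁽ᵐ⁾ = w⁽ᵐ⁻¹⁾`
  have e1 : iteratedDeriv 1 v = w := by rw [iteratedDeriv_one]
  have e2 : iteratedDeriv 2 v = iteratedDeriv 1 w := iteratedDeriv_succ'
  have e3 : iteratedDeriv 3 v = iteratedDeriv 2 w := iteratedDeriv_succ'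
  have e4 : iteratedDeriv 4 v = iteratedDeriv 3 w := iteratedDeriv_succ'
  rw [e1] at u1 u2 u3 u4; rw [e2] at u2 u3 u4; rw [e3] at u3 u4; rw [e4] at u4
  -- exponent monotonicity
  have hc : ∀ m, Continuous (iteratedDeriv m w) := fun m => hws.continuous_iteratedDeriv m (natCast_le_infty'' _)
  have mono : ∀ {q q' : ℝ} (m : ℕ), q' ≤ q → 0 ≤ q' → wsq q (iteratedDeriv m w) ≤ wsq q' (iteratedDeriv m w) := fun m hqq hq' =>
    wsq_mono_exponent hqq (hc m) (integrableOn_sq_mul_sin_rpow hq' (hc m))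
  have a0 : wsq (2 - γ) w ≤ wsq (-eta) w :=
    wsq_mono_exponent (by rw [hη]; linarith) hws.continuous (integrableOn_sq_mul_sin_rpow_neg_eta hws.continuous)
  have a1 : wsq (4 - γ) (iteratedDeriv 1 w) ≤ wsq (2 - γ) (iteratedDeriv 1 w) := mono 1 (by linarith) (by linarith)
  have a2 : wsq (6 - γ) (iteratedDeriv 2 w) ≤ wsq (4 - γ) (iteratedDeriv 2 w) := mono 2 (by linarith) (by linarith)
  have a3 : wsq (8 - γ) (iteratedDeriv 3 w) ≤ wsq (6 - γ) (iteratedDeriv 3 w) := mono 3 (by linarith) (by linarith)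
  have n0 := wsq_nonneg (-eta) w
  have n1 := wsq_nonneg (-γ) (Dθ₁^[1] w)
  have n2 := wsq_nonneg (-γ) (Dθ₁^[2] w)
  have n3 := wsq_nonneg (-γ) (Dθ₁^[3] w)
  have m1 := wsq_nonneg (2 - γ) (iteratedDeriv 1 w)
  have m2 := wsq_nonneg (4 - γ) (iteratedDeriv 2 w)
  have m3 := wsq_nonneg (6 - γ) (iteratedDeriv 3 w)
  have b1 := wsq_nonneg (-γ) (Dθ₁^[1] v)
  have b2 := wsq_nonneg (-γ) (Dθ₁^[2] v)
  have b3 := wsq_nonneg (-γ) (Dθ₁^[3] v)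
  have b4 := wsq_nonneg (-γ) (Dθ₁^[4] v)
  interval_cases n <;> simp only [Finset.sum_range_succ, Finset.sum_range_zero, zero_add, Nat.sub_self, Nat.reduceSub] <;> nlinarith

/-! ### The strip inequality -/

/-- The finite-family transfer with different index ranges on the two sides. [folklore] -/
theorem sum_lintegral_ofReal_le_of_integral_le' {n m : ℕ} {A B : ℕ → ℝ → ℝ} {B₀ : ℝ → ℝ}
    (hA : ∀ i < n, IntegrableOn (A i) (Ioo 0 (π / 2))) (hB : ∀ i < m, IntegrableOn (B i) (Ioo 0 (π / 2)))
    (hB₀ : IntegrableOn B₀ (Ioo 0 (π / 2)))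
    (nA : ∀ i < n, ∀ θ ∈ Ioo 0 (π / 2), 0 ≤ A i θ) (nB : ∀ i < m, ∀ θ ∈ Ioo 0 (π / 2), 0 ≤ B i θ) (nB₀ : ∀ θ ∈ Ioo 0 (π / 2), 0 ≤ B₀ θ)
    {K : ℝ} (hK : 0 ≤ K)
    (h : (∑ i ∈ range n, ∫ θ in Ioo 0 (π / 2), A i θ) ≤ K * ((∑ i ∈ range m, ∫ θ in Ioo 0 (π / 2), B i θ) + ∫ θ in Ioo 0 (π / 2), B₀ θ)) :
    (∑ i ∈ range n, ∫⁻ θ in Ioo 0 (π / 2), ENNReal.ofReal (A i θ)) ≤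
      ENNReal.ofReal K * ((∑ i ∈ range m, ∫⁻ θ in Ioo 0 (π / 2), ENNReal.ofReal (B i θ)) + ∫⁻ θ in Ioo 0 (π / 2), ENNReal.ofReal (B₀ θ)) := by
  have nn : ∀ {C : ℝ → ℝ}, (∀ θ ∈ Ioo 0 (π / 2), 0 ≤ C θ) → 0 ≤ᵐ[volume.restrict (Ioo 0 (π / 2))] C := fun hC =>
    (ae_restrict_iff' measurableSet_Ioo).2 (ae_of_all _ hC)
  have eA : ∑ i ∈ range n, ∫⁻ θ in Ioo 0 (π / 2), ENNReal.ofReal (A i θ) = ENNReal.ofReal (∑ i ∈ range n, ∫ θ in Ioo 0 (π / 2), A i θ) := by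
    rw [ENNReal.ofReal_sum_of_nonneg (fun i hi => setIntegral_nonneg measurableSet_Ioo (nA i (mem_range.1 hi)))]
    exact Finset.sum_congr rfl fun i hi => (ofReal_integral_eq_lintegral_ofReal (hA i (mem_range.1 hi)) (nn (nA i (mem_range.1 hi)))).symm
  have eB : ∑ i ∈ range m, ∫⁻ θ in Ioo 0 (π / 2), ENNReal.ofReal (B i θ) = ENNReal.ofReal (∑ i ∈ range m, ∫ θ in Ioo 0 (π / 2), B i θ) := by
    rw [ENNReal.ofReal_sum_of_nonneg (fun i hi => setIntegral_nonneg measurableSet_Ioo (nB i (mem_range.1 hi)))]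
    exact Finset.sum_congr rfl fun i hi => (ofReal_integral_eq_lintegral_ofReal (hB i (mem_range.1 hi)) (nn (nB i (mem_range.1 hi)))).symm
  have eB₀ : ∫⁻ θ in Ioo 0 (π / 2), ENNReal.ofReal (B₀ θ) = ENNReal.ofReal (∫ θ in Ioo 0 (π / 2), B₀ θ) :=
    (ofReal_integral_eq_lintegral_ofReal hB₀ (nn nB₀)).symm
  have hS : 0 ≤ ∑ i ∈ range m, ∫ θ in Ioo 0 (π / 2), B i θ := Finset.sum_nonneg fun i hi => setIntegral_nonneg measurableSet_Ioo (nB i (mem_range.1 hi))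
  have h0 : 0 ≤ ∫ θ in Ioo 0 (π / 2), B₀ θ := setIntegral_nonneg measurableSet_Ioo nB₀
  rw [eA, eB, eB₀, ← ENNReal.ofReal_add hS h0, ← ENNReal.ofReal_mul hK]
  exact ENNReal.ofReal_le_ofReal h

section Strip

variable {Ψ : ℝ → ℝ → ℝ} (hΨ : Smooth2 Ψ) (h0 : ∀ z, Ψ z 0 = 0) (h1 : ∀ z, Ψ z (π / 2) = 0)
include hΨ

/-- On the strip `∂_θ∂_θD_zʲΨ = D_zʲ∂_θ∂_θΨ`. [folklore] -/
theorem Smooth2.dθ_dθ_iterate_Dz (j : ℕ) {p : ℝ × ℝ} (hp : p ∈ strip) :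
    dθ (dθ (Dz^[j] Ψ)) p.1 p.2 = (Dz^[j] (dθ (dθ Ψ))) p.1 p.2 := by
  rw [dθ_congr (fun q hq => Smooth2.dθ_iterate_Dz hΨ j hq) hp]
  exact Smooth2.dθ_iterate_Dz (Smooth2.smooth2_dθ hΨ) j hp

include h0 h1

/-- **The radial terms**: `‖D_zʲ∂_θΨ·w/s^{η/2}‖² ≤ 500·‖D_zʲ∂_θθΨ·w/s^{η/2}‖²` for every `j`. [folklore] -/
theorem eL2Sq_hkRadialTerm_dθ_le (j : ℕ) :
    eL2Sq (hkRadialTerm j (dθ Ψ)) ≤ ENNReal.ofReal 500 * eL2Sq (hkRadialTerm j (dθ (dθ Ψ))) := by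
  have hd : Smooth2 (dθ Ψ) := Smooth2.smooth2_dθ hΨ
  have hdd : Smooth2 (dθ (dθ Ψ)) := Smooth2.smooth2_dθ hd
  have mA : AEMeasurable (fun p : ℝ × ℝ => ENNReal.ofReal ((hkRadialTerm j (dθ Ψ) p.1 p.2) ^ 2)) (volume.restrict strip) :=
    ((aemeasurable_hkRadialTerm_strip (Smooth2.contDiffOn_strip hd j) le_rfl).pow_const 2).ennreal_ofReal
  have mB : AEMeasurable (fun p : ℝ × ℝ => ENNReal.ofReal ((hkRadialTerm j (dθ (dθ Ψ)) p.1 p.2) ^ 2)) (volume.restrict strip) :=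
    ((aemeasurable_hkRadialTerm_strip (Smooth2.contDiffOn_strip hdd j) le_rfl).pow_const 2).ennreal_ofReal
  rw [eL2Sq_eq_lintegral_ofReal, eL2Sq_eq_lintegral_ofReal, lintegral_strip_eq_radial_theta_ae mA, lintegral_strip_eq_radial_theta_ae mB,
    ← lintegral_const_mul' _ _ ENNReal.ofReal_ne_top]
  refine setLIntegral_mono' measurableSet_Ioi fun z hz => ?_
  have hz' : 0 < z := hz
  -- the slice `u = D_zʲΨ(z,·)`
  set u : ℝ → ℝ := fun θ => (Dz^[j] Ψ) z θ with hu
  have hus : ContDiff ℝ ∞ u := Smooth2.contDiff_slice_iterate_Dz hΨ j z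
  have hu0 : u 0 = 0 := iterate_Dz_apply_eq_zero h0 j z
  have hup : u (π / 2) = 0 := iterate_Dz_apply_eq_zero h1 j z
  have hP := wsq_neg_eta_deriv_le hus hu0 hup
  have hd1 : ∀ θ ∈ Ioo (0:ℝ) (π / 2), deriv u θ = (Dz^[j] (dθ Ψ)) z θ := fun θ hθ => Smooth2.dθ_iterate_Dz hΨ j (p := (z, θ)) ⟨hz', hθ⟩
  have hd2 : ∀ θ ∈ Ioo (0:ℝ) (π / 2), deriv (deriv u) θ = (Dz^[j] (dθ (dθ Ψ))) z θ := fun θ hθ =>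
    Smooth2.dθ_dθ_iterate_Dz hΨ j (p := (z, θ)) ⟨hz', hθ⟩
  have e1 : wsq (-eta) (deriv u) = ∫ θ in Ioo 0 (π / 2), (Dz^[j] (dθ Ψ)) z θ ^ 2 * Real.sin (2 * θ) ^ (-eta) :=
    wsq_congr fun θ hθ => by rw [hd1 θ hθ]
  have e2 : wsq (-eta) (deriv (deriv u)) = ∫ θ in Ioo 0 (π / 2), (Dz^[j] (dθ (dθ Ψ))) z θ ^ 2 * Real.sin (2 * θ) ^ (-eta) :=
    wsq_congr fun θ hθ => by rw [hd2 θ hθ]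
  rw [e1, e2] at hP
  have hw : 0 ≤ radialWeight z ^ 2 := sq_nonneg _
  set A : ℝ → ℝ := fun θ => radialWeight z ^ 2 * ((Dz^[j] (dθ Ψ)) z θ ^ 2 * Real.sin (2 * θ) ^ (-eta)) with hA
  set B : ℝ → ℝ := fun θ => radialWeight z ^ 2 * ((Dz^[j] (dθ (dθ Ψ))) z θ ^ 2 * Real.sin (2 * θ) ^ (-eta)) with hB
  have eA : ∀ θ ∈ Ioo (0:ℝ) (π / 2), ENNReal.ofReal ((hkRadialTerm j (dθ Ψ) z θ) ^ 2) = ENNReal.ofReal (A θ) := fun θ hθ => by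
    rw [sq_hkRadialTerm j (dθ Ψ) (p := (z, θ)) ⟨hz', hθ⟩]; simp only [hA]; congr 1; ring
  have eB : ∀ θ ∈ Ioo (0:ℝ) (π / 2), ENNReal.ofReal ((hkRadialTerm j (dθ (dθ Ψ)) z θ) ^ 2) = ENNReal.ofReal (B θ) := fun θ hθ => by
    rw [sq_hkRadialTerm j (dθ (dθ Ψ)) (p := (z, θ)) ⟨hz', hθ⟩]; simp only [hB]; congr 1; ring
  rw [setLIntegral_congr_fun measurableSet_Ioo eA, setLIntegral_congr_fun measurableSet_Ioo eB]
  have iA : IntegrableOn (fun θ => (Dz^[j] (dθ Ψ)) z θ ^ 2 * Real.sin (2 * θ) ^ (-eta)) (Ioo 0 (π / 2)) :=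
    integrableOn_sq_mul_sin_rpow_neg_eta (Smooth2.contDiff_slice_iterate_Dz hd j z).continuous
  have iB : IntegrableOn (fun θ => (Dz^[j] (dθ (dθ Ψ))) z θ ^ 2 * Real.sin (2 * θ) ^ (-eta)) (Ioo 0 (π / 2)) :=
    integrableOn_sq_mul_sin_rpow_neg_eta (Smooth2.contDiff_slice_iterate_Dz hdd j z).continuous
  have hle' : ∫ θ in Ioo 0 (π / 2), A θ ≤ 500 * ∫ θ in Ioo 0 (π / 2), B θ := by
    simp only [hA, hB, MeasureTheory.integral_const_mul]
    have h := mul_le_mul_of_nonneg_left hP hw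
    linarith
  exact lintegral_ofReal_le_of_integral_le (iA.const_mul _) (iB.const_mul _)
    (fun θ hθ => mul_nonneg hw (mul_nonneg (sq_nonneg _) (Real.rpow_nonneg (sin_two_mul_pos_of_mem hθ).le _)))
    (fun θ hθ => mul_nonneg hw (mul_nonneg (sq_nonneg _) (Real.rpow_nonneg (sin_two_mul_pos_of_mem hθ).le _))) (by norm_num) hle'

omit h0 h1 in
/-- **The angular words at fixed `j`**: for `0 < α ≤ 1` and `n + j ≤ 4`,
`Σ_{i<n} ‖D_θ^{i+1}D_zʲ∂_θΨ·W‖² ≤ 4·10⁹·(Σ_{i<n−1} ‖D_θ^{i+1}D_zʲ∂_θθΨ·W‖² + ‖D_zʲ∂_θθΨ·w/s^{η/2}‖²)`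
(no boundary conditions). [folklore] -/
theorem sum_eL2Sq_hkMixedTerm_dθ_le {α : ℝ} (hα : 0 < α) (hα1 : α ≤ 1) {j n : ℕ} (hnj : n + j ≤ 4) :
    (∑ i ∈ range n, eL2Sq (hkMixedTerm α (i + 1) j (dθ Ψ))) ≤
      ENNReal.ofReal (4 * 10 ^ 9) * ((∑ i ∈ range (n - 1), eL2Sq (hkMixedTerm α (i + 1) j (dθ (dθ Ψ)))) + eL2Sq (hkRadialTerm j (dθ (dθ Ψ)))) := by
  set γ := gammaExp α with hγ
  have hγ1 : 1 < γ := by rw [hγ]; unfold gammaExp; linarith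
  have hγ2 : γ < 2 := by rw [hγ]; unfold gammaExp; linarith
  have hd : Smooth2 (dθ Ψ) := Smooth2.smooth2_dθ hΨ
  have hdd : Smooth2 (dθ (dθ Ψ)) := Smooth2.smooth2_dθ hd
  -- measurability
  have mA : ∀ i, AEMeasurable (fun p : ℝ × ℝ => ENNReal.ofReal ((hkMixedTerm α (i + 1) j (dθ Ψ) p.1 p.2) ^ 2)) (volume.restrict strip) := fun i =>
    ((aemeasurable_hkMixedTerm_strip α (Smooth2.contDiffOn_strip hd (i + 1 + j)) le_rfl).pow_const 2).ennreal_ofReal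
  have mB : ∀ i, AEMeasurable (fun p : ℝ × ℝ => ENNReal.ofReal ((hkMixedTerm α (i + 1) j (dθ (dθ Ψ)) p.1 p.2) ^ 2)) (volume.restrict strip) := fun i =>
    ((aemeasurable_hkMixedTerm_strip α (Smooth2.contDiffOn_strip hdd (i + 1 + j)) le_rfl).pow_const 2).ennreal_ofReal
  have mR : AEMeasurable (fun p : ℝ × ℝ => ENNReal.ofReal ((hkRadialTerm j (dθ (dθ Ψ)) p.1 p.2) ^ 2)) (volume.restrict strip) :=
    ((aemeasurable_hkRadialTerm_strip (Smooth2.contDiffOn_strip hdd j) le_rfl).pow_const 2).ennreal_ofReal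
  have L : ∀ i, eL2Sq (hkMixedTerm α (i + 1) j (dθ Ψ)) = ∫⁻ z in Ioi 0, ∫⁻ θ in Ioo 0 (π / 2), ENNReal.ofReal ((hkMixedTerm α (i + 1) j (dθ Ψ) z θ) ^ 2) :=
    fun i => by rw [eL2Sq_eq_lintegral_ofReal, lintegral_strip_eq_radial_theta_ae (mA i)]
  have RD : ∀ i, eL2Sq (hkMixedTerm α (i + 1) j (dθ (dθ Ψ))) = ∫⁻ z in Ioi 0, ∫⁻ θ in Ioo 0 (π / 2), ENNReal.ofReal ((hkMixedTerm α (i + 1) j (dθ (dθ Ψ)) z θ) ^ 2) :=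
    fun i => by rw [eL2Sq_eq_lintegral_ofReal, lintegral_strip_eq_radial_theta_ae (mB i)]
  have RR : eL2Sq (hkRadialTerm j (dθ (dθ Ψ))) = ∫⁻ z in Ioi 0, ∫⁻ θ in Ioo 0 (π / 2), ENNReal.ofReal ((hkRadialTerm j (dθ (dθ Ψ)) z θ) ^ 2) := by
    rw [eL2Sq_eq_lintegral_ofReal, lintegral_strip_eq_radial_theta_ae mR]
  simp only [L, RD, RR]
  rw [← lintegral_finsetSum' _ (fun i _ => aemeasurable_lintegral_slice (mA i)),
    ← lintegral_finsetSum' _ (fun i _ => aemeasurable_lintegral_slice (mB i)),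
    ← lintegral_add_left' (Finset.aemeasurable_fun_sum _ fun i _ => aemeasurable_lintegral_slice (mB i)),
    ← lintegral_const_mul' _ _ ENNReal.ofReal_ne_top]
  refine setLIntegral_mono' measurableSet_Ioi fun z hz => ?_
  have hz' : 0 < z := hz
  -- the slice `v = D_zʲ∂_θΨ(z,·)`
  set v : ℝ → ℝ := fun θ => (Dz^[j] (dθ Ψ)) z θ with hv
  have hvs : ContDiff ℝ ∞ v := Smooth2.contDiff_slice_iterate_Dz hd j z
  have hdv : ∀ θ ∈ Ioo (0:ℝ) (π / 2), deriv v θ = (Dz^[j] (dθ (dθ Ψ))) z θ := fun θ hθ => Smooth2.dθ_iterate_Dz hd j (p := (z, θ)) ⟨hz', hθ⟩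
  have core := sum_wsq_iterate_Dθ₁_le_deriv hγ1 hγ2 hvs (n := n) (by omega)
  have e1 : ∀ i, wsq (-γ) (Dθ₁^[i + 1] (deriv v)) = wsq (-γ) (Dθ₁^[i + 1] fun θ' => (Dz^[j] (dθ (dθ Ψ))) z θ') := fun i =>
    wsq_congr fun θ hθ => by rw [iterate_Dθ₁_congr_of_Ioo hdv (i + 1) θ hθ]
  have e2 : wsq (-eta) (deriv v) = wsq (-eta) fun θ' => (Dz^[j] (dθ (dθ Ψ))) z θ' := wsq_congr fun θ hθ => by rw [hdv θ hθ]
  simp only [e1, e2] at core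
  -- integrability of the word integrands
  obtain ⟨iv, -⟩ := wsq_iterate_Dθ₁_le hγ2 hvs
  obtain ⟨iw, -⟩ := wsq_iterate_Dθ₁_le hγ2 (Smooth2.contDiff_slice_iterate_Dz hdd j z)
  have iR : IntegrableOn (fun θ => (Dz^[j] (dθ (dθ Ψ))) z θ ^ 2 * Real.sin (2 * θ) ^ (-eta)) (Ioo 0 (π / 2)) :=
    integrableOn_sq_mul_sin_rpow_neg_eta (Smooth2.contDiff_slice_iterate_Dz hdd j z).continuous
  have hw : 0 ≤ radialWeight z ^ 2 := sq_nonneg _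
  set A : ℕ → ℝ → ℝ := fun i θ => radialWeight z ^ 2 * ((Dθ₁^[i + 1] v) θ ^ 2 * Real.sin (2 * θ) ^ (-γ)) with hA
  set B : ℕ → ℝ → ℝ := fun i θ => radialWeight z ^ 2 * ((Dθ₁^[i + 1] fun θ' => (Dz^[j] (dθ (dθ Ψ))) z θ') θ ^ 2 * Real.sin (2 * θ) ^ (-γ)) with hB
  set B₀ : ℝ → ℝ := fun θ => radialWeight z ^ 2 * ((Dz^[j] (dθ (dθ Ψ))) z θ ^ 2 * Real.sin (2 * θ) ^ (-eta)) with hB₀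
  have eA : ∀ i, ∀ θ ∈ Ioo (0:ℝ) (π / 2), ENNReal.ofReal ((hkMixedTerm α (i + 1) j (dθ Ψ) z θ) ^ 2) = ENNReal.ofReal (A i θ) := fun i θ hθ => by
    rw [sq_hkMixedTerm α (i + 1) j (dθ Ψ) (p := (z, θ)) ⟨hz', hθ⟩]
    simp only [iterate_Dθ_apply, hA]; congr 1; ring
  have eB : ∀ i, ∀ θ ∈ Ioo (0:ℝ) (π / 2), ENNReal.ofReal ((hkMixedTerm α (i + 1) j (dθ (dθ Ψ)) z θ) ^ 2) = ENNReal.ofReal (B i θ) := fun i θ hθ => by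
    rw [sq_hkMixedTerm α (i + 1) j (dθ (dθ Ψ)) (p := (z, θ)) ⟨hz', hθ⟩]
    simp only [iterate_Dθ_apply, hB]; congr 1; ring
  have eB₀ : ∀ θ ∈ Ioo (0:ℝ) (π / 2), ENNReal.ofReal ((hkRadialTerm j (dθ (dθ Ψ)) z θ) ^ 2) = ENNReal.ofReal (B₀ θ) := fun θ hθ => by
    rw [sq_hkRadialTerm j (dθ (dθ Ψ)) (p := (z, θ)) ⟨hz', hθ⟩]
    simp only [hB₀]; congr 1; ring
  rw [Finset.sum_congr rfl fun i _ => setLIntegral_congr_fun measurableSet_Ioo (eA i),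
    Finset.sum_congr rfl fun i _ => setLIntegral_congr_fun measurableSet_Ioo (eB i), setLIntegral_congr_fun measurableSet_Ioo eB₀]
  have hle' : (∑ i ∈ range n, ∫ θ in Ioo 0 (π / 2), A i θ) ≤ 4 * 10 ^ 9 * ((∑ i ∈ range (n - 1), ∫ θ in Ioo 0 (π / 2), B i θ) + ∫ θ in Ioo 0 (π / 2), B₀ θ) := by
    simp only [hA, hB, hB₀, MeasureTheory.integral_const_mul, ← Finset.mul_sum]
    have h := mul_le_mul_of_nonneg_left core hw
    have e : radialWeight z ^ 2 * (4 * 10 ^ 9 * ((∑ i ∈ range (n - 1), wsq (-γ) (Dθ₁^[i + 1] fun θ' => (Dz^[j] (dθ (dθ Ψ))) z θ')) +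
        wsq (-eta) fun θ' => (Dz^[j] (dθ (dθ Ψ))) z θ')) =
        4 * 10 ^ 9 * (radialWeight z ^ 2 * (∑ i ∈ range (n - 1), wsq (-γ) (Dθ₁^[i + 1] fun θ' => (Dz^[j] (dθ (dθ Ψ))) z θ')) +
        radialWeight z ^ 2 * wsq (-eta) fun θ' => (Dz^[j] (dθ (dθ Ψ))) z θ') := by ring
    simp only [wsq] at h e
    linarith
  have nn : ∀ (x : ℝ) {θ : ℝ}, θ ∈ Ioo (0:ℝ) (π / 2) → ∀ q : ℝ, 0 ≤ radialWeight z ^ 2 * (x ^ 2 * Real.sin (2 * θ) ^ q) := fun x θ hθ q =>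
    mul_nonneg hw (mul_nonneg (sq_nonneg _) (Real.rpow_nonneg (sin_two_mul_pos_of_mem hθ).le _))
  exact sum_lintegral_ofReal_le_of_integral_le' (fun i hi => (iv (i + 1) (by omega) (by omega)).const_mul _)
    (fun i hi => (iw (i + 1) (by omega) (by omega)).const_mul _) (iR.const_mul _)
    (fun i _ θ hθ => nn _ hθ _) (fun i _ θ hθ => nn _ hθ _) (fun θ hθ => nn _ hθ _) (by norm_num) hle'

/-- **`|∂_θΨ|²_{𝓗⁴} ≤ 10¹²·|∂_θθΨ|²_{𝓗⁴}`** for `Ψ` smooth on `ℝ²` vanishing on `θ = 0` and `θ = π/2`,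
`0 < α ≤ 1` (the tree's `eHkNormSq α 4`). [folklore] -/
theorem eHkNormSq_dθ_le {α : ℝ} (hα : 0 < α) (hα1 : α ≤ 1) :
    eHkNormSq α 4 (dθ Ψ) ≤ ENNReal.ofReal (10 ^ 12) * eHkNormSq α 4 (dθ (dθ Ψ)) := by
  set E := eHkNormSq α 4 (dθ (dθ Ψ)) with hE
  have hB := eHkNormSq_le_of_forall_le (α := α) (k := 4) (f := dθ Ψ) (B := ENNReal.ofReal (2 * 10 ^ 10) * E)
    (fun j hj => by
      refine (eL2Sq_hkRadialTerm_dθ_le hΨ h0 h1 j).trans ?_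
      have hr : eL2Sq (hkRadialTerm j (dθ (dθ Ψ))) ≤ E := eL2Sq_hkRadialTerm_le α hj _
      calc ENNReal.ofReal 500 * eL2Sq (hkRadialTerm j (dθ (dθ Ψ))) ≤ ENNReal.ofReal 500 * E := by gcongr
        _ ≤ ENNReal.ofReal (2 * 10 ^ 10) * E := by gcongr; norm_num)
    (fun i j hi hij => by
      obtain ⟨i', rfl⟩ : ∃ i', i = i' + 1 := ⟨i - 1, by omega⟩
      have hs : eL2Sq (hkMixedTerm α (i' + 1) j (dθ Ψ)) ≤ ∑ i ∈ range (4 - j), eL2Sq (hkMixedTerm α (i + 1) j (dθ Ψ)) :=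
        Finset.single_le_sum (f := fun i => eL2Sq (hkMixedTerm α (i + 1) j (dθ Ψ))) (fun _ _ => bot_le) (mem_range.2 (by omega))
      refine hs.trans ((sum_eL2Sq_hkMixedTerm_dθ_le hΨ hα hα1 (n := 4 - j) (j := j) (by omega)).trans ?_)
      have h5 : (∑ i ∈ range (4 - j - 1), eL2Sq (hkMixedTerm α (i + 1) j (dθ (dθ Ψ)))) + eL2Sq (hkRadialTerm j (dθ (dθ Ψ))) ≤ 5 * E := by
        have hsum : (∑ i ∈ range (4 - j - 1), eL2Sq (hkMixedTerm α (i + 1) j (dθ (dθ Ψ)))) ≤ 4 * E := by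
          have h1' : ∀ i ∈ range (4 - j - 1), eL2Sq (hkMixedTerm α (i + 1) j (dθ (dθ Ψ))) ≤ E := fun i hi =>
            eL2Sq_hkMixedTerm_le α (by omega) (by have := mem_range.1 hi; omega) _
          calc (∑ i ∈ range (4 - j - 1), eL2Sq (hkMixedTerm α (i + 1) j (dθ (dθ Ψ)))) ≤ ∑ _i ∈ range (4 - j - 1), E := Finset.sum_le_sum h1'
            _ = ((4 - j - 1 : ℕ) : ℝ≥0∞) * E := by rw [Finset.sum_const, Finset.card_range, nsmul_eq_mul]
            _ ≤ 4 * E := by gcongr; exact_mod_cast (by omega : 4 - j - 1 ≤ 4)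
        have hr : eL2Sq (hkRadialTerm j (dθ (dθ Ψ))) ≤ E := eL2Sq_hkRadialTerm_le α (by omega) _
        calc (∑ i ∈ range (4 - j - 1), eL2Sq (hkMixedTerm α (i + 1) j (dθ (dθ Ψ)))) + eL2Sq (hkRadialTerm j (dθ (dθ Ψ))) ≤ 4 * E + E :=
            add_le_add hsum hr
          _ = 5 * E := by ring
      calc ENNReal.ofReal (4 * 10 ^ 9) * ((∑ i ∈ range (4 - j - 1), eL2Sq (hkMixedTerm α (i + 1) j (dθ (dθ Ψ)))) + eL2Sq (hkRadialTerm j (dθ (dθ Ψ))))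
          ≤ ENNReal.ofReal (4 * 10 ^ 9) * (5 * E) := by gcongr
        _ = ENNReal.ofReal (2 * 10 ^ 10) * E := by
            rw [← mul_assoc, show (5 : ℝ≥0∞) = ENNReal.ofReal 5 by norm_num, ← ENNReal.ofReal_mul (by norm_num)]
            norm_num)
  refine hB.trans ?_
  rw [← mul_assoc]
  gcongr
  rw [show (((4 + 1) + (4 + 1) ^ 2 : ℕ) : ℝ≥0∞) = ENNReal.ofReal 30 by norm_num, ← ENNReal.ofReal_mul (by norm_num)]
  exact ENNReal.ofReal_le_ofReal (by norm_num)

end Strip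

end Elgindi

end Literature.Analysis.FluidPDE
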